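import Summits.AnomalousDissipation.AnomalousDissipation.Theorems.SawtoothPulseCascadeK1LocalisedCascadeWindowBlockVO
import Summits.AnomalousDissipation.AnomalousDissipation.Theorems.SawtoothPulseCascadeK1LocalisedCascadeWindowBlockHO
import Summits.AnomalousDissipation.AnomalousDissipation.Theorems.SawtoothPulseCascadeK1LocalisedCascadeClassStepH

/-!
# THE OSCILLATORY WINDOW BLOCKS AT THE LEVEL OF THE CASCADE ITERATES

(S-B/S-C assembly seat; the LEDGER ASSEMBLY, layer L2, Osc grade.)  ad-sawtooth-k1loc-p1 g7's oscillatory window-block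
theorems `…WindowBlockVO.sum_windowBlock_vstep_osc_le` / `…WindowBlockHO.sum_windowBlock_hstep_osc_le` are stated for a
generic continuous `b` with `‖b‖ ≤ 1` and summable Fourier coefficients; this file specialises them to the cascade iterates
(`a_{j+1} = b_j ∘ shear`, `b_j = a_j ∘ shear`), exactly as `…ClassStepV/H.sum_window_iterate_{v,h}step_le` do for the plain
blocks.  These are the per-block inputs of `…ClassBlocksOsc`.
No definitions; no statement about the crux.
-/

-- `Summit.<Summit>.<Problem>`: single-conjunct summit, the duplicate namespace segment is deliberate.
set_option linter.dupNamespace false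

noncomputable section

namespace Summit.AnomalousDissipation.AnomalousDissipation.Theorems.SawtoothPulseCascade.K1Window

open MeasureTheory Set Filter Topology UnitAddTorus Function Complex Metric
open scoped Real ENNReal
open Literature.Analysis Literature.Analysis.FunctionSpaces Literature.Analysis.FunctionSpaces.Torus Literature.Analysis.FluidPDE
open Literature.Analysis.FluidPDE.ShearStage
open Literature.Analysis.FluidPDE.SawtoothCascade Literature.Analysis.FluidPDE.SawtoothCascade.CascadeParams
open Summit.AnomalousDissipation.AnomalousDissipation.Theorems.SawtoothPulseCascade.K1Start
open Summit.AnomalousDissipation.AnomalousDissipation.Theorems.SawtoothPulseCascade.K1Flat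
open Summit.AnomalousDissipation.AnomalousDissipation.Theorems.SawtoothPulseCascade.K1Ledger.From

section Cascade

variable (P : CascadeParams)

/-! ## §0 The iterate-level oscillatory window blocks -/

/-- **Oscillatory V window block for the cascade iterates**: `…WindowBlockVO.sum_windowBlock_vstep_osc_le` applied to
`b = b_j` (smooth, `|b_j| ≤ 1`, summable Fourier coefficients), whose shear image is `a_{j+1}`.
[cite: Grafakos2014, Prop. 3.1.2 (5), Prop. 3.2.7 (3), §3.1.3] -/
theorem sum_window_iterate_vstep_osc_le {G : ℕ} (hγ : P.γ = G) (hδ₀ : 0 < P.δ₀) (hd : 0 < P.d) (hN₀ : 1 ≤ P.N₀)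
    (hρN : 1 ≤ P.ρN) (a b : ℕ → UnitAddTorus (Fin 2) → ℝ) (has : ∀ j, IsSmooth (a j)) (h0 : a 0 = datum)
    (hb : ∀ j, b j = a j ∘ shearMap 0 1 (amp ⟨P.U j, P.U_periodic j, P.contDiff_U (P.δ_pos hδ₀ hd j)⟩ P.γ))
    (hab : ∀ j, a (j + 1) = b j ∘ shearMap 1 0 (amp ⟨P.U j, P.U_periodic j, P.contDiff_U (P.δ_pos hδ₀ hd j)⟩ P.γ))
    (j : ℕ) {Q₁ Q₂ Λ Λ' : ℕ} (hQ : Q₁ < Q₂) (p : ℤ → ℕ)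
    (W : Finset (Fin 2 → ℤ)) (hW : ∀ k ∈ W, (Λ : ℤ) ≤ |k 1| ∧ |k 1| ≤ Λ')
    (hWp : ∀ k ∈ W, |k 0| + Q₂ ≤ (p (k 1) : ℤ)) (hpG : ∀ k ∈ W, p (k 1) < (k 1).natAbs * G)
    {d₀ M ε₀ A Dm : ℝ} (hd₀ : 0 < d₀) (hM : 1 ≤ M) (hMδ : M * P.δ j < π / 2) (hMd : M * P.δ j < π * P.N j * d₀)
    (hA0 : 0 ≤ A) (hA : ∀ k ∈ W, ((p (k 1) : ℝ) + ((k 1).natAbs * G : ℕ)) / ((((k 1).natAbs * G : ℕ) : ℝ) - p (k 1)) ≤ A)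
    (hDm : 0 < Dm) (hD : ∀ k ∈ W, Dm ≤ (((k 1).natAbs * G : ℕ) : ℝ) - p (k 1))
    (hAd : 1 / (2 * π * Dm) + 4 * M * P.δ j / (π * Dm * d₀) ≤ A * d₀) (hε0 : 0 ≤ ε₀)
    (hε : A * (2 * π * ((Λ' * G : ℕ) : ℝ) * (Real.exp (-(M ^ 2 / 2)) / (2 * P.N j))) + 2 * P.N j / (π * Dm) ≤ ε₀) :
    ∑ k ∈ W, ‖mFourierCoeff (fun x => (a (j + 1) x : ℂ)) k‖ ^ 2 ≤
      ((((Q₁ : ℝ) + Q₂) / ((Q₂ : ℝ) - Q₁)) * (ε₀ + A * Real.sqrt ((2 * P.N j : ℕ) * (4 * d₀))) +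
        Real.sqrt (∑' k : Fin 2 → ℤ, (if (Λ : ℤ) ≤ |k 1| ∧ |k 1| ≤ Λ' ∧ (Q₁ : ℤ) < |k 0| then (1 : ℝ) else 0) *
          ‖mFourierCoeff (fun x => (b j x : ℂ)) k‖ ^ 2)) ^ 2 := by
  set Ψ : ShearProfile := amp ⟨P.U j, P.U_periodic j, P.contDiff_U (P.δ_pos hδ₀ hd j)⟩ P.γ with hΨ
  set bC : UnitAddTorus (Fin 2) → ℂ := fun x => (b j x : ℂ) with hbC
  have hbs : IsSmooth (b j) := isSmooth_b P hδ₀ hd a b has hb j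
  have hbc : Continuous bC := Complex.continuous_ofReal.comp hbs.continuous
  have hbsum : Summable fun k => ‖mFourierCoeff bC k‖ := summable_norm_mFourierCoeff_ofReal_of_isSmooth hbs
  have hb1 : ∀ x, ‖bC x‖ ≤ 1 := fun x => by
    simp only [hbC, Complex.norm_real, Real.norm_eq_abs]
    exact (abs_iterate_le_one P hδ₀ hd a b h0 hb hab j).2 x
  have haC' : (fun x => (a (j + 1) x : ℂ)) = bC ∘ shearMap 1 0 Ψ := by
    show (fun x => (a (j + 1) x : ℂ)) = (fun x => (b j x : ℂ)) ∘ shearMap 1 0 Ψ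
    rw [hab j]; rfl
  rw [haC']
  exact sum_windowBlock_vstep_osc_le P hγ hδ₀ hd hN₀ hρN j hbc hbsum hb1 hQ p W hW hWp hpG hd₀ hM hMδ hMd hA0 hA hDm hD hAd
    hε0 hε

/-- **Oscillatory H window block for the cascade iterates**: `…WindowBlockHO.sum_windowBlock_hstep_osc_le` applied to
`a = a_j` (smooth, `|a_j| ≤ 1`, summable Fourier coefficients), whose shear image is `b_j`.
[cite: Grafakos2014, Prop. 3.1.2 (5), Prop. 3.2.7 (3), §3.1.3] -/
theorem sum_window_iterate_hstep_osc_le {G : ℕ} (hγ : P.γ = G) (hδ₀ : 0 < P.δ₀) (hd : 0 < P.d) (hN₀ : 1 ≤ P.N₀)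
    (hρN : 1 ≤ P.ρN) (a b : ℕ → UnitAddTorus (Fin 2) → ℝ) (has : ∀ j, IsSmooth (a j)) (h0 : a 0 = datum)
    (hb : ∀ j, b j = a j ∘ shearMap 0 1 (amp ⟨P.U j, P.U_periodic j, P.contDiff_U (P.δ_pos hδ₀ hd j)⟩ P.γ))
    (hab : ∀ j, a (j + 1) = b j ∘ shearMap 1 0 (amp ⟨P.U j, P.U_periodic j, P.contDiff_U (P.δ_pos hδ₀ hd j)⟩ P.γ))
    (j : ℕ) {Q₁ Q₂ Λ Λ' : ℕ} (hQ : Q₁ < Q₂) (p : ℤ → ℕ)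
    (W : Finset (Fin 2 → ℤ)) (hW : ∀ k ∈ W, (Λ : ℤ) ≤ |k 0| ∧ |k 0| ≤ Λ')
    (hWp : ∀ k ∈ W, |k 1| + Q₂ ≤ (p (k 0) : ℤ)) (hpG : ∀ k ∈ W, p (k 0) < (k 0).natAbs * G)
    {d₀ M ε₀ A Dm : ℝ} (hd₀ : 0 < d₀) (hM : 1 ≤ M) (hMδ : M * P.δ j < π / 2) (hMd : M * P.δ j < π * P.N j * d₀)
    (hA0 : 0 ≤ A) (hA : ∀ k ∈ W, ((p (k 0) : ℝ) + ((k 0).natAbs * G : ℕ)) / ((((k 0).natAbs * G : ℕ) : ℝ) - p (k 0)) ≤ A)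
    (hDm : 0 < Dm) (hD : ∀ k ∈ W, Dm ≤ (((k 0).natAbs * G : ℕ) : ℝ) - p (k 0))
    (hAd : 1 / (2 * π * Dm) + 4 * M * P.δ j / (π * Dm * d₀) ≤ A * d₀) (hε0 : 0 ≤ ε₀)
    (hε : A * (2 * π * ((Λ' * G : ℕ) : ℝ) * (Real.exp (-(M ^ 2 / 2)) / (2 * P.N j))) + 2 * P.N j / (π * Dm) ≤ ε₀) :
    ∑ k ∈ W, ‖mFourierCoeff (fun x => (b j x : ℂ)) k‖ ^ 2 ≤
      ((((Q₁ : ℝ) + Q₂) / ((Q₂ : ℝ) - Q₁)) * (ε₀ + A * Real.sqrt ((2 * P.N j : ℕ) * (4 * d₀))) +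
        Real.sqrt (∑' k : Fin 2 → ℤ, (if (Λ : ℤ) ≤ |k 0| ∧ |k 0| ≤ Λ' ∧ (Q₁ : ℤ) < |k 1| then (1 : ℝ) else 0) *
          ‖mFourierCoeff (fun x => (a j x : ℂ)) k‖ ^ 2)) ^ 2 := by
  set Ψ : ShearProfile := amp ⟨P.U j, P.U_periodic j, P.contDiff_U (P.δ_pos hδ₀ hd j)⟩ P.γ with hΨ
  set aC : UnitAddTorus (Fin 2) → ℂ := fun x => (a j x : ℂ) with haC
  have has' : IsSmooth (a j) := has j
  have hac : Continuous aC := Complex.continuous_ofReal.comp has'.continuous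
  have hasum : Summable fun k => ‖mFourierCoeff aC k‖ := summable_norm_mFourierCoeff_ofReal_of_isSmooth has'
  have ha1 : ∀ x, ‖aC x‖ ≤ 1 := fun x => by
    simp only [haC, Complex.norm_real, Real.norm_eq_abs]
    exact (abs_iterate_le_one P hδ₀ hd a b h0 hb hab j).1 x
  have hbC' : (fun x => (b j x : ℂ)) = aC ∘ shearMap 0 1 Ψ := by
    show (fun x => (b j x : ℂ)) = (fun x => (a j x : ℂ)) ∘ shearMap 0 1 Ψ
    rw [hb j]; rfl
  rw [hbC']
  exact sum_windowBlock_hstep_osc_le P hγ hδ₀ hd hN₀ hρN j hac hasum ha1 hQ p W hW hWp hpG hd₀ hM hMδ hMd hA0 hA hDm hD hAd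
    hε0 hε


end Cascade

end Summit.AnomalousDissipation.AnomalousDissipation.Theorems.SawtoothPulseCascade.K1Window
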